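import Literature.NumberTheory.EllipticCurves.ModularFormsGamma1Dimension
import HarnessLib

/-!
# The weight-two residue relation for a finite-index level and the sharp lower bound
# `[SL(2, ℤ) : ±Γ₁(N)] + 12 ≤ 12 dim S₂(Γ₁(N)) + 6ε_∞` (`N ≥ 4`)

Helper file (route `ClassRecordThree`, crux `EulerHalvesAtThree`, residue (ESᶜ-surj-Γ(M)) of the
Cartan-cover line). The tree's `ModularFormsGamma1Dimension` proves, for `N ≥ 4` and even `k`,
`(k-1)μ₁ + 6ε_∞ ≤ 12 dim M_k(Γ₁(N))` and `dim M_k(±Γ₁(N)) ≤ dim S_k + ε_∞`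
(`Level.finrank_levelSpace_le_finrank_cuspForm_add`), whence `μ₁ - 6ε_∞ ≤ 12 dim S₂(Γ₁(N))` in weight
`2` — one dimension short of the truth `12 dim S₂ = 12g = μ₁ - 6ε_∞ + 12`. The missing dimension is
the **residue theorem**: the cusp values `(v(f ∣ b))_b` of a weight-`2` form satisfy the linear
relation `∑_b w(b) v(f ∣ b) = 0` (the trace `∑_x f ∣ x` to level one is a weight-`2` level-one form,
hence `0`), so the cusp-value map lands in a hyperplane and `dim M₂(Γ) + 1 ≤ dim S₂(Γ) + ε_∞(Γ)`.
This is the verbatim port of the `§Residue` section of `ModularFormsGamma0Genus` (there for `Γ₀(N)`)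
to an arbitrary finite-index level `Γ ∋ T` on the `Level` vocabulary
(`Level.cosetSlash/cuspValuesK/kerToCuspFormK/basePoints/width`), followed by its assembly with the
`Γ₁(N)` dimension bound:

* `Level.finrank_levelSpace_two_add_one_le` : `dim M₂(Γ) + 1 ≤ dim S₂(Γ) + #basePoints Γ`;
* `index_gamma1pm_add_twelve_le` : `[SL(2, ℤ) : ±Γ₁(N)] + 12 ≤ 12 dim S₂(Γ₁(N)) + 6 #basePoints(±Γ₁(N))`
  for `N ≥ 4` — i.e. `dim S₂(Γ₁(N)) ≥ g(X₁(N))`, the existence half of the genus formula in weight `2`.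

All proved; no named facts; nothing here is specific to BSD.

## References

* F. Diamond, J. Shurman, *A first course in modular forms*, GTM 228 (2005), Thm. 3.5.1, Thm. 3.6.1,
  Fig. 3.4; §3.3 (holomorphic differentials and weight-two forms).
* G. Shimura, *Introduction to the arithmetic theory of automorphic functions* (1971), Thm. 2.23,
  Prop. 2.16.
-/

noncomputable section

open UpperHalfPlane hiding I
open ModularForm Complex Matrix.SpecialLinearGroup Filter Asymptotics CongruenceSubgroup
open EisensteinSeries ModularGroup
open scoped MatrixGroups Real ModularForm Topology Manifold

set_option linter.dupNamespace false

namespace Summit.BirchSwinnertonDyer.BirchSwinnertonDyer.Theorems.EichlerShimuraLevel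

open Literature.NumberTheory.EllipticCurves.ModularForms
open scoped Classical

/-! ### The residue relation in weight two for a finite-index level -/

section Residue

variable {Γ : Subgroup SL(2, ℤ)} [Γ.FiniteIndex] [Fintype (SL(2, ℤ) ⧸ Γ)]

/-- **The trace to level one vanishes in weight `2`**: `∑_x f ∣ x ∈ M₂(SL₂(ℤ)) = 0` for
`f ∈ M₂(Γ)`. [folklore] -/
theorem sum_cosetSlash_two_eq_zero {f : ℍ → ℂ} (hf : f ∈ Level.levelSpace Γ 2) :
    ∑ x : SL(2, ℤ) ⧸ Γ, Level.cosetSlash Γ 2 f x = 0 := by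
  have hF := Level.slash_eq_of_mem_levelSpace hf
  have hinv : ∀ g : SL(2, ℤ),
      (∑ x : SL(2, ℤ) ⧸ Γ, Level.cosetSlash Γ 2 f x) ∣[(2 : ℤ)] (g : GL (Fin 2) ℝ) =
        ∑ x : SL(2, ℤ) ⧸ Γ, Level.cosetSlash Γ 2 f x := by
    intro g
    rw [SlashAction.sum_slash]
    simp_rw [Level.cosetSlash_slash hF]
    exact Equiv.sum_comp (MulAction.toPerm (g⁻¹ : SL(2, ℤ)))
      (fun x ↦ Level.cosetSlash Γ 2 f x)
  have hmem : (∑ x : SL(2, ℤ) ⧸ Γ, Level.cosetSlash Γ 2 f x) ∈ levelOneSpace 2 := by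
    rw [mem_formSpace_iff]
    refine ⟨?_, ?_, fun g ↦ ?_⟩
    · exact mdifferentiable_finset_sum (Finset.univ : Finset (SL(2, ℤ) ⧸ Γ))
        (f := fun x ↦ Level.cosetSlash Γ 2 f x) fun x _ ↦ Level.mdifferentiable_cosetSlash hf x
    · rintro _ ⟨g, rfl⟩
      exact hinv g
    · rw [hinv g]
      exact isBoundedAtImInfty_sum _ fun x _ ↦ Level.isBoundedAtImInfty_cosetSlash hf x
  obtain ⟨Q, hQ⟩ := hmem
  rw [← hQ, rank_zero_iff_forall_zero.mp ModularForm.levelOne_weight_two_rank_zero Q]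
  rfl

/-- **The residue relation**: `∑_x v(f ∣ x) = 0` for `f ∈ M₂(Γ)`. [folklore] -/
theorem sum_valueAtInfty_two_eq_zero {f : ℍ → ℂ} (hf : f ∈ Level.levelSpace Γ 2) :
    ∑ x : SL(2, ℤ) ⧸ Γ, valueAtInfty (Level.cosetSlash Γ 2 f x) = 0 := by
  have h1 : Tendsto (fun τ ↦ ∑ x : SL(2, ℤ) ⧸ Γ, Level.cosetSlash Γ 2 f x τ) atImInfty
      (𝓝 (∑ x : SL(2, ℤ) ⧸ Γ, valueAtInfty (Level.cosetSlash Γ 2 f x))) :=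
    tendsto_finsetSum _ fun x _ ↦ Level.tendsto_cosetSlash hf x
  have h2 : (fun τ ↦ ∑ x : SL(2, ℤ) ⧸ Γ, Level.cosetSlash Γ 2 f x τ) = 0 := by
    funext τ
    have := congr_fun (sum_cosetSlash_two_eq_zero hf) τ
    simpa [Finset.sum_apply] using this
  rw [h2] at h1
  exact (tendsto_nhds_unique tendsto_const_nhds h1).symm ▸ rfl

end Residue

/-! ### The cusp-value map in weight two lands in a hyperplane: `dim M₂(Γ) + 1 ≤ dim S₂(Γ) + ε_∞` -/

section CuspValues

variable {Γ : Subgroup SL(2, ℤ)} [Γ.FiniteIndex]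

/-- The residue relation over the cusps: `∑_{b base point} w(b) · v(f ∣ b) = 0`. [folklore] -/
theorem sum_width_mul_valueAtInfty_two_eq_zero {f : ℍ → ℂ} (hf : f ∈ Level.levelSpace Γ 2) :
    ∑ b ∈ Level.basePoints Γ, (Level.width Γ b : ℂ) * valueAtInfty (Level.cosetSlash Γ 2 f b) =
      0 := by
  letI : Fintype (SL(2, ℤ) ⧸ Γ) := Fintype.ofFinite _
  rw [← sum_valueAtInfty_two_eq_zero hf, ← Finset.sum_fiberwise_of_maps_to (s := Finset.univ)
    (t := Level.basePoints Γ) (g := Level.base Γ) (fun x _ ↦ Level.base_mem_basePoints x)]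
  refine Finset.sum_congr rfl fun b hb ↦ ?_
  have hb' : Level.base Γ b = b := (Finset.mem_filter.mp hb).2
  rw [Finset.sum_congr rfl fun x (hx : x ∈ Finset.univ.filter fun x ↦ Level.base Γ x = b) ↦ by
    rw [Level.valueAtInfty_cosetSlash_eq_base hf x, (Finset.mem_filter.mp hx).2]]
  rw [Finset.sum_const, nsmul_eq_mul, Level.filter_base_eq b hb', Level.card_orbitFin]

variable (Γ) in
/-- The weighted-sum functional `v ↦ ∑_b w(b) v_b` on `ℂ^{base points}`. [folklore] -/
def widthSum : ({x // x ∈ Level.basePoints Γ} → ℂ) →ₗ[ℂ] ℂ :=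
  ∑ b : {x // x ∈ Level.basePoints Γ}, (Level.width Γ b.1 : ℂ) • LinearMap.proj b

/-- The cusp values of a weight-`2` form satisfy the residue relation. [folklore] -/
theorem range_cuspValuesK_two_le :
    LinearMap.range (Level.cuspValuesK Γ 2) ≤ LinearMap.ker (widthSum Γ) := by
  rintro _ ⟨f, rfl⟩
  rw [LinearMap.mem_ker, widthSum, LinearMap.sum_apply]
  simp only [LinearMap.smul_apply, LinearMap.proj_apply, Level.cuspValuesK, LinearMap.pi_apply,
    smul_eq_mul]
  have hv : ∀ x : {x // x ∈ Level.basePoints Γ},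
      (Level.cuspValueK Γ 2 x.1) f = valueAtInfty (Level.cosetSlash Γ 2 (f : ℍ → ℂ) x.1) :=
    fun x ↦ rfl
  simp_rw [hv]
  rw [Finset.sum_coe_sort (Level.basePoints Γ)
    (fun b ↦ (Level.width Γ b : ℂ) * valueAtInfty (Level.cosetSlash Γ 2 (f : ℍ → ℂ) b))]
  exact sum_width_mul_valueAtInfty_two_eq_zero f.2

/-- `dim ker(widthSum) + 1 ≤ #(base points)` (the functional is nonzero: widths are positive).
[folklore] -/
theorem finrank_ker_widthSum_add_one_le :
    Module.finrank ℂ (LinearMap.ker (widthSum Γ)) + 1 ≤ (Level.basePoints Γ).card := by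
  have hrn := LinearMap.finrank_range_add_finrank_ker (widthSum Γ)
  rw [Module.finrank_fintype_fun_eq_card, Fintype.card_coe] at hrn
  set b₀ : {x // x ∈ Level.basePoints Γ} :=
    ⟨Level.base Γ ((1 : SL(2, ℤ)) : SL(2, ℤ) ⧸ Γ), Level.base_mem_basePoints _⟩
  have hne : widthSum Γ (Pi.single b₀ 1) ≠ 0 := by
    rw [widthSum, LinearMap.sum_apply]
    simp only [LinearMap.smul_apply, LinearMap.proj_apply, smul_eq_mul]
    rw [Finset.sum_eq_single b₀ (fun b _ hb ↦ by rw [Pi.single_eq_of_ne hb, mul_zero])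
      (fun h ↦ absurd (Finset.mem_univ _) h), Pi.single_eq_same, mul_one]
    exact_mod_cast (Level.width_pos Γ _).ne'
  have hpos : 1 ≤ Module.finrank ℂ (LinearMap.range (widthSum Γ)) := by
    rw [Nat.one_le_iff_ne_zero, Ne, Submodule.finrank_eq_zero, LinearMap.range_eq_bot]
    intro h0
    exact hne (by rw [h0]; rfl)
  omega

variable (Γ) in
/-- **`dim M₂(Γ) + 1 ≤ dim S₂(Γ) + ε_∞(Γ)`** (`ε_∞ = #basePoints Γ`) for a finite-index level
`Γ ∋ T` with `S₂(Γ)` finite-dimensional: rank–nullity for the weight-`2` cusp-value map, whose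
image lies in the residue hyperplane `∑_b w(b) v_b = 0` and whose kernel consists of cusp forms.
[folklore] -/
theorem finrank_levelSpace_two_add_one_le [Fact (ModularGroup.T ∈ Γ)]
    [FiniteDimensional ℂ (CuspForm Γ 2)] :
    Module.finrank ℂ (Level.levelSpace Γ 2) + 1 ≤
      Module.finrank ℂ (CuspForm Γ 2) + (Level.basePoints Γ).card := by
  have hrn := LinearMap.finrank_range_add_finrank_ker (Level.cuspValuesK Γ 2)
  have h1 : Module.finrank ℂ (LinearMap.range (Level.cuspValuesK Γ 2)) ≤
      Module.finrank ℂ (LinearMap.ker (widthSum Γ)) :=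
    Submodule.finrank_mono range_cuspValuesK_two_le
  have h2 := finrank_ker_widthSum_add_one_le (Γ := Γ)
  have h3 : Module.finrank ℂ (LinearMap.ker (Level.cuspValuesK Γ 2)) ≤
      Module.finrank ℂ (CuspForm Γ 2) :=
    LinearMap.finrank_le_finrank_of_injective (Level.kerToCuspFormK_injective (Γ := Γ) (k := 2))
  omega

end CuspValues

/-! ### `[SL(2, ℤ) : ±Γ₁(N)] + 12 ≤ 12 dim S₂(Γ₁(N)) + 6ε_∞` -/

/-- `S₂(Γ₁(N))` is finite-dimensional (Sturm, `T ∈ Γ₁(N)`), `N ≠ 0`. [folklore] -/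
theorem finiteDimensional_cuspForm_gamma1_two (N : ℕ) [NeZero N] :
    FiniteDimensional ℂ (CuspForm (Gamma1 N) 2) := by
  have hT1 : ModularGroup.T ∈ Gamma1 N := by
    rw [Gamma1_mem]
    simp [ModularGroup.T]
  have h1p : (1 : ℝ) ∈ ((Gamma1 N : Subgroup SL(2, ℤ)) : Subgroup (GL (Fin 2) ℝ)).strictPeriods := by
    rw [Subgroup.strictPeriods_eq_zmultiples_one_of_T_mem hT1]
    exact AddSubgroup.mem_zmultiples (1 : ℝ)
  exact (finiteDimensional_cuspForm_and_finrank_le (𝒢 := Gamma1 N) (k := 2) h1p).1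

/-- **`[SL(2, ℤ) : ±Γ₁(N)] + 12 ≤ 12 dim S₂(Γ₁(N)) + 6 #basePoints(±Γ₁(N))` for `N ≥ 4`**, i.e.
`dim S₂(Γ₁(N)) ≥ g` with `12(g - 1) = μ₁ - 6ε_∞` (Diamond–Shurman Thm. 3.5.1 / Fig. 3.4 in weight
`2`, existence half): the dimension bound `μ₁ + 6ε_∞ ≤ 12 dim M₂(Γ₁(N))`
(`twelve_mul_finrank_modularForm_gamma1_ge`) combined with the residue hyperplane
`dim M₂(±Γ₁(N)) + 1 ≤ dim S₂(±Γ₁(N)) + ε_∞` (`finrank_levelSpace_two_add_one_le`) and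
`S₂(±Γ₁(N)) ↪ S₂(Γ₁(N))`. [cite: DiamondShurman2005, Thm. 3.5.1, Fig. 3.4] -/
theorem index_gamma1pm_add_twelve_le (N : ℕ) [NeZero N] (hN : 4 ≤ N) :
    (Gamma1pm N).index + 12 ≤
      12 * Module.finrank ℂ (CuspForm (Gamma1 N) 2) + 6 * (Level.basePoints (Gamma1pm N)).card := by
  haveI : FiniteDimensional ℂ (CuspForm (Gamma1 N) 2) := finiteDimensional_cuspForm_gamma1_two N
  have h1 := twelve_mul_finrank_modularForm_gamma1_ge N hN (k := 2) even_two
  have h2 := finrank_levelSpace_two_add_one_le (Gamma1pm N)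
  have h3 := finrank_cuspForm_gamma1pm_le N 2
  rw [← finrank_formSpace, ← formSpace_gamma1pm_eq_of_even N even_two] at h1
  have h2' : (Module.finrank ℂ (formSpace (Gamma1pm N) 2) : ℤ) + 1 ≤
      Module.finrank ℂ (CuspForm (Gamma1 N) 2) + (Level.basePoints (Gamma1pm N)).card := by
    exact_mod_cast h2.trans (Nat.add_le_add_right h3 _)
  have : ((Gamma1pm N).index : ℤ) + 12 ≤
      12 * Module.finrank ℂ (CuspForm (Gamma1 N) 2) + 6 * (Level.basePoints (Gamma1pm N)).card := by
    linarith
  exact_mod_cast this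

end Summit.BirchSwinnertonDyer.BirchSwinnertonDyer.Theorems.EichlerShimuraLevel

end
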